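import Mathlib
import Summits.Ventures.PercRepro2.Defs
import Summits.Ventures.PercRepro2.Independence
import Summits.Ventures.PercRepro2.Harris
import Summits.Ventures.PercRepro2.Graph
import Summits.Ventures.PercRepro2.Exploration
import Summits.Ventures.PercRepro2.Events
import Summits.Ventures.PercRepro2.FourFunctions
import Summits.Ventures.PercRepro2.Induced
import Summits.Ventures.PercRepro2.Frontier
import Summits.Ventures.PercRepro2.ObsIndependence
import Summits.Ventures.PercRepro2.BHK
import Summits.Ventures.PercRepro2.BHKEvents
import Summits.Ventures.PercRepro2.SideAgreement
import Summits.Ventures.PercRepro2.VdBKahn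
import Summits.Ventures.PercRepro2.BHKAvoid
import Summits.Ventures.PercRepro2.R2PrimeThreeReduction
import Summits.Ventures.PercRepro2.YBridge
import Summits.Ventures.PercRepro2.Yu1Functionals
import Summits.Ventures.PercRepro2.Yu1Events
import Summits.Ventures.PercRepro2.Yu1
import Summits.Ventures.PercRepro2.LBSplit
import Summits.Ventures.PercRepro2.YDelta
import Summits.Ventures.PercRepro2.SD
import Summits.Ventures.PercRepro2.Threshold
import Summits.Ventures.PercRepro2.Lambda
import Summits.Ventures.PercRepro2.LambdaTau
import Summits.Ventures.PercRepro2.LambdaSlack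
import Summits.Ventures.PercRepro2.HF2
import Summits.Ventures.PercRepro2.Yu2
import Summits.Ventures.PercRepro2.N0
import Summits.Ventures.PercRepro2.Y
import Summits.Ventures.PercRepro2.YDeltaTools
import Summits.Ventures.PercRepro2.ZDelta
import Summits.Ventures.PercRepro2.ZExpand
import Summits.Ventures.PercRepro2.ISplit
import Summits.Ventures.PercRepro2.MRl
import Summits.Ventures.PercRepro2.ZOloc
import Summits.Ventures.PercRepro2.SideBridge
import Summits.Ventures.PercRepro2.HCov
import Summits.Ventures.PercRepro2.TriDisagreement
import Summits.Ventures.PercRepro2.TriDisagreementPinned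
import Summits.Ventures.PercRepro2.HCovFns
import Summits.Ventures.PercRepro2.HCovCubic

/-!
# The crux from the weight-free typed three-copy bases (blind cell PercRepro2, typer-1; p1 g6
2026-08-23T06:08:36Z, row 2′TRI)

* **`TypedBases`**: the weight-free hypothesis of row 2′TRI for the kernel `K₃` — every typed
  3-colouring count `typedCount F z τ K₃` with types in `{1, 2}` on `F` is nonnegative (census
  0 / 92,021,760 at n = 5, three implementations);
* **`HCov_of_typedBases`**: `TypedBases → HCov p …` for every admissible `p` (p1's
  `triSum_nonneg_of_typedCount` + `hcov_cubic`);
* **`ZDelta_of_typedBases`**: the crux of record for every labelled instance from the typed bases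
  (`ZDelta_of_HCov`).
-/

namespace Summit.Ventures.PercRepro2

open UnionCluster

namespace CovForm

section Typed

variable {V : Type*} {E : Type*} [Fintype E] [DecidableEq E] [Fintype V] [DecidableEq V]
  {R : Type*} [Field R] [LinearOrder R] [IsStrictOrderedRing R]

/-- **Row 2′TRI for `K₃`**: every typed three-copy count of `K₃` with types in `{1, 2}` on the typed
edges is nonnegative (weight-free: a statement about 3-colourings of minors). -/
def TypedBases (ends : E → Sym2 V) (o a₁ a₂ a₃ b : V) : Prop :=
  ∀ (F : Finset E) (z : Config E) (τ : E → ℕ), (∀ e ∈ F, τ e = 1 ∨ τ e = 2) →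
    0 ≤ typedCount F z τ (K3 ends o a₁ a₂ a₃ b : Config E → Config E → Config E → R)

omit [Fintype V] [DecidableEq V] in
/-- **(HCOV) from the typed bases** for every admissible weight vector. -/
theorem HCov_of_typedBases (ends : E → Sym2 V) (o a₁ a₂ a₃ b : V)
    (h : TypedBases (R := R) ends o a₁ a₂ a₃ b) (p : E → R) (hp : IsProbVec p) :
    HCov p ends o a₁ a₂ a₃ b := by
  unfold HCov
  rw [hcov_cubic p ends o a₁ a₂ a₃ b (fun _ => 0)]
  exact triSum_nonneg_of_typedCount (K3 ends o a₁ a₂ a₃ b) h p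
    (fun e => ⟨hp.nonneg e, hp.le_one e⟩) ∅ (fun _ => 0)
    (fun e he => absurd he (Finset.notMem_empty e))

/-- **The crux from the typed bases**: `ZDelta` for every labelled admissible instance. -/
theorem ZDelta_of_typedBases (ends : E → Sym2 V) {o a₁ a₂ a₃ b : V}
    (h : TypedBases (R := R) ends o a₁ a₂ a₃ b) (p : E → R) (hp : IsProbVec p)
    (hord : prob p (connEvent ends a₁ b) ≤ prob p (connEvent ends a₂ b)) :
    ZDelta p ends o a₁ a₂ a₃ b :=
  ZDelta_of_HCov p hp ends hord (HCov_of_typedBases ends o a₁ a₂ a₃ b h p hp)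

end Typed

end CovForm

end Summit.Ventures.PercRepro2
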